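import Summits.CriticalPhenomena.PercolationContinuityZ3.Theorems.PercNearOneGluingNoHeavyLowerTailKNGoodThreeRelaysKNMass
import HarnessLib

/-!
# `NoHeavyLowerTail` (stmt-CriticalPhenomena-4575) — the POCKET LIFT of Kozma–Nitzan's Theorem 2, event level

Support file (`--supports stmt-CriticalPhenomena-4575`, hull-port prover `prim-hp-2`, gen 23).  No new definitions, no named
facts, no sorries; standard axioms.

Kozma–Nitzan (arXiv:2401.12397) Theorem 2 (p. 8): for three relays `a, t, c` with `c` the least reliable
(`P(c↔b) ≤ P(a↔b), P(t↔b)`) and `m_c ≤ m_{at}` (`P(b↔c, b↮a, b↮t) ≤ P(b↔a, b↔t, b↮c)`), the pre-FKG inequality (3)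
holds.  Their proof — the decomposition `I + II + III`, six BHK applications and the superadditivity Lemma 2 — lifts word
for word to POCKET-AUGMENTED events (the tree's (II) `KNGoodPocketBHK.real_pocketAugSet_inter_ge`, its sink form
`real_pocketAugSet_sink_le`, and `pocket_superadditive`).  This file proves the resulting event-level inequality, for
ARBITRARY disjoint families `𝒬_a, 𝒬_t` of vertex sets missing `a, t, c` ("hairless pockets"):

* `KNGoodThreeKN.core` — with `𝓐 = {o↔a} ∪ {C(o)∈𝒬_a}`, `𝓣 = {o↔t} ∪ {C(o)∈𝒬_t}`:
  `μ(c↔b, o↮b, o↔{a,t}) + μ(C(o)∈𝒬_a, c↔b, a↮b) + μ(C(o)∈𝒬_t, c↔b, t↮b)`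
  `≤ μ(o↔b, c↮b, o↔{a,t}) + μ(C(o)∈𝒬_a, a↔b, c↮b) + μ(C(o)∈𝒬_t, t↔b, c↮b)`.
  With the designee families of the goodness functional this is strong goodness of `(G, {a,t,c}, o, b)` (prim-hp-2
  MEMO-gen23 §7–8; the wrapper to `KNGood` is a separate file).
[cite: KozmaNitzan2024, Thm. 2 (p. 8), Lemma 1–2 (pp. 5–6), §3.2 Definition (p. 12)]
[cite: VandenbergHaggstromKahn2005, Thm. 1.1 (pp. 3–5), Remark 1 (p. 5)]
-/

noncomputable section

namespace Summit.CriticalPhenomena.PercolationContinuityZ3.Theorems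

open MeasureTheory Set Literature.Probability.LatticeModels Literature.Probability.Percolation
open scoped Classical

namespace KNGoodThreeKN

open KNGoodPocketBHK

variable {V : Type*} [Fintype V]

/-- **The pocket lift of Kozma–Nitzan's Theorem 2 (event level).**  `o, b` vertices, relays `a, t, c`; `𝒬_a, 𝒬_t` disjoint
families of vertex sets missing `a, t, c`; hypotheses: `c` is the least reliable relay (`P(c↔b) ≤ P(a↔b)`,
`P(c↔b) ≤ P(t↔b)`) and Kozma–Nitzan's `m_c ≤ m_{at}` (`P(c↔b, a↮b, t↮b) ≤ P(a↔b, t↔b, c↮b)`).  Then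
`μ(c↔b, o↮b, o↔{a,t}) + μ(C(o)∈𝒬_a, c↔b, a↮b) + μ(C(o)∈𝒬_t, c↔b, t↮b)`
`≤ μ(o↔b, c↮b, o↔{a,t}) + μ(C(o)∈𝒬_a, a↔b, c↮b) + μ(C(o)∈𝒬_t, t↔b, c↮b)`.
[cite: KozmaNitzan2024, Thm. 2 (p. 8), Lemma 2 (p. 6)] [cite: VandenbergHaggstromKahn2005, Thm. 1.1 (pp. 3–5)] -/
theorem core (w : Sym2 V → unitInterval) (o b a t c : V) (Qa Qt : Set (Set V))
    (hQa : ∀ W ∈ Qa, a ∉ W ∧ t ∉ W ∧ c ∉ W) (hQt : ∀ W ∈ Qt, a ∉ W ∧ t ∉ W ∧ c ∉ W) (hdis : Disjoint Qa Qt)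
    (hca : (prodBernoulli w).real (openConn c b) ≤ (prodBernoulli w).real (openConn a b))
    (hct : (prodBernoulli w).real (openConn c b) ≤ (prodBernoulli w).real (openConn t b))
    (hKN : (prodBernoulli w).real (openConn c b ∩ (openConn a b)ᶜ ∩ (openConn t b)ᶜ) ≤
      (prodBernoulli w).real (openConn a b ∩ openConn t b ∩ (openConn c b)ᶜ)) :
    (prodBernoulli w).real (openConn c b ∩ (openConn o b)ᶜ ∩ (openConn o a ∪ openConn o t)) +
        (prodBernoulli w).real (pk o Qa ∩ (openConn c b ∩ (openConn a b)ᶜ)) +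
        (prodBernoulli w).real (pk o Qt ∩ (openConn c b ∩ (openConn t b)ᶜ)) ≤
      (prodBernoulli w).real (openConn o b ∩ (openConn c b)ᶜ ∩ (openConn o a ∪ openConn o t)) +
        (prodBernoulli w).real (pk o Qa ∩ (openConn a b ∩ (openConn c b)ᶜ)) +
        (prodBernoulli w).real (pk o Qt ∩ (openConn t b ∩ (openConn c b)ᶜ)) := by
  classical
  set μ := prodBernoulli w with hμ
  haveI : IsProbabilityMeasure μ := by rw [hμ]; infer_instance
  have hmeas : ∀ A : Set (BondConfig V), MeasurableSet A := fun _ => MeasurableSet.of_discrete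
  have eL := real_lhs_eq w o b a t c Qa Qt hQa hQt hdis
  have eR := real_rhs_eq w o b a t c Qa Qt hQa hQt hdis
  have Ma := real_cb_split_a w a t c b
  have Mb := real_ab_split w a t c b
  have Mc := real_cb_split_t w a t c b
  have Md := real_tb_split w a t c b
  have MKN1 := mc_set_eq w a t c b
  have MKN2 := mK_set_eq w a t c b
  ---------------------------------------------------------------- events
  set DK : Set (BondConfig V) := avoidSet {a, t} {c} with hDK
  set Da : Set (BondConfig V) := avoidSet {a} {t, c} with hDa
  set Dt : Set (BondConfig V) := avoidSet {t} {a, c} with hDt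
  set F : Set (BondConfig V) := pocketAugSet {a, t} o (Qa ∪ Qt) with hF
  set FA : Set (BondConfig V) := pocketAugSet {a} o Qa with hFA
  set FT : Set (BondConfig V) := pocketAugSet {t} o Qt with hFT
  set h5 : Set (BondConfig V) := openConn a t ∩ (openConn a b ∪ openConn t b) with hh5
  set g : Set (BondConfig V) := openConn c b with hg
  set hab : Set (BondConfig V) := openConn a b with hhab
  set htb : Set (BondConfig V) := openConn t b with hhtb
  set g9 : Set (BondConfig V) := openConn t c ∩ openConn t b with hg9
  set g8 : Set (BondConfig V) := openConn a c ∩ openConn a b with hg8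
  have memDK : ∀ ω, ω ∈ DK ↔ ¬ (openGraph ω).Reachable a c ∧ ¬ (openGraph ω).Reachable t c := fun ω => by
    rw [hDK]; exact mem_avoidSet_two_one a t c ω
  have memDa : ∀ ω, ω ∈ Da ↔ ¬ (openGraph ω).Reachable a t ∧ ¬ (openGraph ω).Reachable a c := fun ω => by
    rw [hDa]; exact mem_avoidSet_one_two a t c ω
  have memDt : ∀ ω, ω ∈ Dt ↔ ¬ (openGraph ω).Reachable t a ∧ ¬ (openGraph ω).Reachable t c := fun ω => by
    rw [hDt]; exact mem_avoidSet_one_two t a c ω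
  have memF : ∀ ω, ω ∈ F ↔ ((openGraph ω).Reachable o a ∨ (openGraph ω).Reachable o t) ∨
      openCluster ω o ∈ Qa ∪ Qt := fun ω => by rw [hF]; exact mem_pocketAugSet_two a t o _ ω
  have memFA : ∀ ω, ω ∈ FA ↔ (openGraph ω).Reachable o a ∨ openCluster ω o ∈ Qa := fun ω => by
    rw [hFA]; exact mem_pocketAugSet_one a o Qa ω
  have memFT : ∀ ω, ω ∈ FT ↔ (openGraph ω).Reachable o t ∨ openCluster ω o ∈ Qt := fun ω => by
    rw [hFT]; exact mem_pocketAugSet_one t o Qt ω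
  -- pockets exclude the relays from `C(o)`
  have pkQa : ∀ ω, openCluster ω o ∈ Qa → ¬ (openGraph ω).Reachable o a ∧ ¬ (openGraph ω).Reachable o t ∧
      ¬ (openGraph ω).Reachable o c := fun ω hW =>
    ⟨fun h => (hQa _ hW).1 h, fun h => (hQa _ hW).2.1 h, fun h => (hQa _ hW).2.2 h⟩
  have pkQt : ∀ ω, openCluster ω o ∈ Qt → ¬ (openGraph ω).Reachable o a ∧ ¬ (openGraph ω).Reachable o t ∧
      ¬ (openGraph ω).Reachable o c := fun ω hW =>
    ⟨fun h => (hQt _ hW).1 h, fun h => (hQt _ hW).2.1 h, fun h => (hQt _ hW).2.2 h⟩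
  ---------------------------------------------------------------- the six (II)/(II)' bounds and superadditivity
  have hQc : ∀ W ∈ Qa ∪ Qt, Disjoint W ({c} : Set V) := by
    rintro W (hW | hW)
    · exact Set.disjoint_singleton_right.2 (hQa W hW).2.2
    · exact Set.disjoint_singleton_right.2 (hQt W hW).2.2
  have hQa' : ∀ W ∈ Qa, Disjoint W ({t, c} : Set V) := by
    intro W hW; rw [Set.disjoint_left]; intro x hxW hx
    rcases hx with rfl | hx
    · exact (hQa W hW).2.1 hxW
    · rw [Set.mem_singleton_iff] at hx; subst hx; exact (hQa W hW).2.2 hxW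
  have hQt' : ∀ W ∈ Qt, Disjoint W ({a, c} : Set V) := by
    intro W hW; rw [Set.disjoint_left]; intro x hxW hx
    rcases hx with rfl | hx
    · exact (hQt W hW).1 hxW
    · rw [Set.mem_singleton_iff] at hx; subst hx; exact (hQt W hW).2.2 hxW
  have adm_h5 : ∀ ω ω' : BondConfig V, ω ∈ h5 →
      (⋃ x ∈ ({a, t} : Set V), openEdgeCluster ω x) ⊆ (⋃ x ∈ ({a, t} : Set V), openEdgeCluster ω' x) → ω' ∈ h5 := by
    rw [hh5]
    exact inter_determinedBy_biUnion _ (openConn_determinedBy_biUnion {a, t} (by simp) t)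
      (union_determinedBy_biUnion _ (openConn_determinedBy_biUnion {a, t} (by simp) b)
        (openConn_determinedBy_biUnion {a, t} (by simp) b))
  have adm_g : ∀ ω ω' : BondConfig V, ω ∈ g →
      (⋃ x ∈ ({c} : Set V), openEdgeCluster ω x) ⊆ (⋃ x ∈ ({c} : Set V), openEdgeCluster ω' x) → ω' ∈ g := by
    rw [hg]; exact openConn_determinedBy_biUnion {c} (by simp) b
  have adm_g9 : ∀ ω ω' : BondConfig V, ω ∈ g9 →
      (⋃ x ∈ ({t, c} : Set V), openEdgeCluster ω x) ⊆ (⋃ x ∈ ({t, c} : Set V), openEdgeCluster ω' x) → ω' ∈ g9 := by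
    rw [hg9]
    exact inter_determinedBy_biUnion _ (openConn_determinedBy_biUnion {t, c} (by simp) c)
      (openConn_determinedBy_biUnion {t, c} (by simp) b)
  have adm_g8 : ∀ ω ω' : BondConfig V, ω ∈ g8 →
      (⋃ x ∈ ({a, c} : Set V), openEdgeCluster ω x) ⊆ (⋃ x ∈ ({a, c} : Set V), openEdgeCluster ω' x) → ω' ∈ g8 := by
    rw [hg8]
    exact inter_determinedBy_biUnion _ (openConn_determinedBy_biUnion {a, c} (by simp) c)
      (openConn_determinedBy_biUnion {a, c} (by simp) b)
  have b1 : μ.real (h5 ∩ DK) * μ.real (F ∩ DK) ≤ μ.real DK * μ.real (h5 ∩ (F ∩ DK)) := by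
    have := real_pocketAugSet_inter_ge w ({a, t} : Set V) {c} o (Qa ∪ Qt) hQc h5 adm_h5
    rw [← hμ] at this; exact this
  have b2 : μ.real DK * μ.real (g ∩ (F ∩ DK)) ≤ μ.real (g ∩ DK) * μ.real (F ∩ DK) := by
    have := real_pocketAugSet_sink_le w ({a, t} : Set V) {c} o (Qa ∪ Qt) hQc g adm_g
    rw [← hμ] at this; exact this
  have b3 : μ.real (hab ∩ Da) * μ.real (FA ∩ Da) ≤ μ.real Da * μ.real (hab ∩ (FA ∩ Da)) := by
    have := real_pocketAugSet_openConn_ge w ({a} : Set V) {t, c} a b o (by simp) Qa hQa'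
    rw [← hμ] at this; exact this
  have b4 : μ.real Da * μ.real (g9 ∩ (FA ∩ Da)) ≤ μ.real (g9 ∩ Da) * μ.real (FA ∩ Da) := by
    have := real_pocketAugSet_sink_le w ({a} : Set V) {t, c} o Qa hQa' g9 adm_g9
    rw [← hμ] at this; exact this
  have b5 : μ.real (htb ∩ Dt) * μ.real (FT ∩ Dt) ≤ μ.real Dt * μ.real (htb ∩ (FT ∩ Dt)) := by
    have := real_pocketAugSet_openConn_ge w ({t} : Set V) {a, c} t b o (by simp) Qt hQt'
    rw [← hμ] at this; exact this
  have b6 : μ.real Dt * μ.real (g8 ∩ (FT ∩ Dt)) ≤ μ.real (g8 ∩ Dt) * μ.real (FT ∩ Dt) := by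
    have := real_pocketAugSet_sink_le w ({t} : Set V) {a, c} o Qt hQt' g8 adm_g8
    rw [← hμ] at this; exact this
  have hQa3 : ∀ W ∈ Qa, t ∉ W ∧ c ∉ W := fun W hW => ⟨(hQa W hW).2.1, (hQa W hW).2.2⟩
  have hQt3 : ∀ W ∈ Qt, a ∉ W ∧ c ∉ W := fun W hW => ⟨(hQt W hW).1, (hQt W hW).2.2⟩
  have psa : μ.real (FA ∩ Da) * μ.real Dt * μ.real DK + μ.real (FT ∩ Dt) * μ.real Da * μ.real DK ≤
      μ.real (F ∩ DK) * μ.real Da * μ.real Dt := by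
    have := pocket_superadditive w o a t c Qa Qt hQa3 hQt3 hdis
    rw [← hμ] at this; exact this
  ---------------------------------------------------------------- the arithmetic (KN p. 9)
  rw [← hμ] at eL; rw [← hμ] at eR; rw [← hμ] at Ma; rw [← hμ] at Mb; rw [← hμ] at Mc; rw [← hμ] at Md
  rw [eL, eR]
  rw [MKN1, MKN2] at hKN
  have Ha' : μ.real (g ∩ DK) + μ.real (g9 ∩ Da) ≤ μ.real (h5 ∩ DK) + μ.real (hab ∩ Da) := by
    have := hca; rw [Ma, Mb] at this; linarith
  have Ht' : μ.real (g ∩ DK) + μ.real (g8 ∩ Dt) ≤ μ.real (h5 ∩ DK) + μ.real (htb ∩ Dt) := by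
    have := hct; rw [Mc, Md] at this; linarith
  -- names
  set dK := μ.real DK with hdK
  set fK := μ.real (F ∩ DK)
  set u5 := μ.real (h5 ∩ (F ∩ DK))
  set q5 := μ.real (h5 ∩ DK)
  set d67 := μ.real (g ∩ (F ∩ DK))
  set q67 := μ.real (g ∩ DK)
  set da := μ.real Da with hda
  set fa := μ.real (FA ∩ Da)
  set rA := μ.real (hab ∩ (FA ∩ Da))
  set qRa := μ.real (hab ∩ Da)
  set d9 := μ.real (g9 ∩ (FA ∩ Da))
  set q9 := μ.real (g9 ∩ Da)
  set dt := μ.real Dt with hdt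
  set ft := μ.real (FT ∩ Dt)
  set rT := μ.real (htb ∩ (FT ∩ Dt))
  set qRt := μ.real (htb ∩ Dt)
  set d8 := μ.real (g8 ∩ (FT ∩ Dt))
  set q8 := μ.real (g8 ∩ Dt)
  have h0dK : 0 ≤ dK := measureReal_nonneg
  have h0da : 0 ≤ da := measureReal_nonneg
  have h0dt : 0 ≤ dt := measureReal_nonneg
  have h0fK : 0 ≤ fK := measureReal_nonneg
  have h0fa : 0 ≤ fa := measureReal_nonneg
  have h0ft : 0 ≤ ft := measureReal_nonneg
  have h0rA : 0 ≤ rA := measureReal_nonneg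
  have h0rT : 0 ≤ rT := measureReal_nonneg
  have h0u5 : 0 ≤ u5 := measureReal_nonneg
  have hu5 : u5 ≤ dK := measureReal_mono (inter_subset_right.trans inter_subset_right)
  have hd67 : d67 ≤ dK := measureReal_mono (inter_subset_right.trans inter_subset_right)
  have hq5 : q5 ≤ dK := measureReal_mono inter_subset_right
  have hq67 : q67 ≤ dK := measureReal_mono inter_subset_right
  have hfKle : fK ≤ dK := measureReal_mono inter_subset_right
  have hrA : rA ≤ da := measureReal_mono (inter_subset_right.trans inter_subset_right)
  have hd9 : d9 ≤ da := measureReal_mono (inter_subset_right.trans inter_subset_right)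
  have hfale : fa ≤ da := measureReal_mono inter_subset_right
  have hrT : rT ≤ dt := measureReal_mono (inter_subset_right.trans inter_subset_right)
  have hd8 : d8 ≤ dt := measureReal_mono (inter_subset_right.trans inter_subset_right)
  have hftle : ft ≤ dt := measureReal_mono inter_subset_right
  have h0d67 : 0 ≤ d67 := measureReal_nonneg
  have h0d9 : 0 ≤ d9 := measureReal_nonneg
  have h0d8 : 0 ≤ d8 := measureReal_nonneg
  -- the three difference bounds (no division)
  have A1 : fK * (q5 - q67) ≤ dK * (u5 - d67) := by linarith [b1, b2]
  have A2 : fa * (qRa - q9) ≤ da * (rA - d9) := by linarith [b3, b4]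
  have A3 : ft * (qRt - q8) ≤ dt * (rT - d8) := by linarith [b5, b6]
  have hKN0 : 0 ≤ q5 - q67 := by linarith
  -- Harris for the degenerate cases
  have hDa_eq : Da = (openConn a t)ᶜ ∩ (openConn a c)ᶜ := by
    ext ω; simp only [memDa, Set.mem_inter_iff, Set.mem_compl_iff, openConn, Set.mem_setOf_eq]
  have hDt_eq : Dt = (openConn t a)ᶜ ∩ (openConn t c)ᶜ := by
    ext ω; simp only [memDt, Set.mem_inter_iff, Set.mem_compl_iff, openConn, Set.mem_setOf_eq]
  have harris_a : μ.real ((openConn a t)ᶜ) * μ.real ((openConn a c)ᶜ) ≤ da := by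
    have h := prodBernoulli_harris_lower w (isUpperSet_openConn a t).compl (isUpperSet_openConn a c).compl
      (hmeas _) (hmeas _)
    rw [← hμ] at h; rw [hda, hDa_eq]; exact h
  have harris_t : μ.real ((openConn t a)ᶜ) * μ.real ((openConn t c)ᶜ) ≤ dt := by
    have h := prodBernoulli_harris_lower w (isUpperSet_openConn t a).compl (isUpperSet_openConn t c).compl
      (hmeas _) (hmeas _)
    rw [← hμ] at h; rw [hdt, hDt_eq]; exact h
  have hdK_le_ac : dK ≤ μ.real ((openConn a c : Set (BondConfig V))ᶜ) :=
    measureReal_mono (fun ω hω => by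
      rw [memDK] at hω; simpa only [Set.mem_compl_iff, openConn, Set.mem_setOf_eq] using hω.1)
  have hdK_le_tc : dK ≤ μ.real ((openConn t c : Set (BondConfig V))ᶜ) :=
    measureReal_mono (fun ω hω => by
      rw [memDK] at hω; simpa only [Set.mem_compl_iff, openConn, Set.mem_setOf_eq] using hω.2)
  have hdt_le_ta : dt ≤ μ.real ((openConn a t : Set (BondConfig V))ᶜ) :=
    measureReal_mono (fun ω hω => by
      rw [memDt] at hω
      simp only [Set.mem_compl_iff, openConn, Set.mem_setOf_eq]
      exact fun h => hω.1 h.symm)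
  have hda_le_at : da ≤ μ.real ((openConn t a : Set (BondConfig V))ᶜ) :=
    measureReal_mono (fun ω hω => by
      rw [memDa] at hω
      simp only [Set.mem_compl_iff, openConn, Set.mem_setOf_eq]
      exact fun h => hω.1 h.symm)
  by_cases hK0 : dK = 0
  · -- all of world 5/6/7 vanish
    have hu50 : u5 = 0 := le_antisymm (hK0 ▸ hu5) h0u5
    have hd670 : d67 = 0 := le_antisymm (hK0 ▸ hd67) h0d67
    have hq50 : q5 = 0 := le_antisymm (hK0 ▸ hq5) measureReal_nonneg
    have hq670 : q67 = 0 := le_antisymm (hK0 ▸ hq67) measureReal_nonneg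
    rw [hq50, hq670] at Ha' Ht'
    have Ea : d9 ≤ rA := by
      by_cases ha0 : da = 0
      · have : d9 = 0 := le_antisymm (ha0 ▸ hd9) h0d9
        rw [this]; exact h0rA
      · have hpos : 0 < da := lt_of_le_of_ne h0da (Ne.symm ha0)
        have h1 : 0 ≤ fa * (qRa - q9) := mul_nonneg h0fa (by linarith)
        have h2 : 0 ≤ da * (rA - d9) := le_trans h1 A2
        have h3 := (mul_nonneg_iff_of_pos_left hpos).1 h2
        linarith
    have Et : d8 ≤ rT := by
      by_cases ht0 : dt = 0
      · have : d8 = 0 := le_antisymm (ht0 ▸ hd8) h0d8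
        rw [this]; exact h0rT
      · have hpos : 0 < dt := lt_of_le_of_ne h0dt (Ne.symm ht0)
        have h1 : 0 ≤ ft * (qRt - q8) := mul_nonneg h0ft (by linarith)
        have h2 : 0 ≤ dt * (rT - d8) := le_trans h1 A3
        have h3 := (mul_nonneg_iff_of_pos_left hpos).1 h2
        linarith
    rw [hu50, hd670]; linarith
  · have hKpos : 0 < dK := lt_of_le_of_ne h0dK (Ne.symm hK0)
    by_cases hmain : 0 < da ∧ 0 < dt
    · obtain ⟨hapos, htpos⟩ := hmain
      have S1 : da * dt * (fK * (q5 - q67)) ≤ dK * da * dt * (u5 - d67) := by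
        have := mul_le_mul_of_nonneg_left A1 (mul_nonneg h0da h0dt); linarith [this]
      have S2 : (q5 - q67) * (fa * dt * dK + ft * da * dK) ≤ da * dt * (fK * (q5 - q67)) := by
        have := mul_le_mul_of_nonneg_left psa hKN0; linarith [this]
      have S3 : dK * dt * (fa * (qRa - q9)) ≤ dK * da * dt * (rA - d9) := by
        have := mul_le_mul_of_nonneg_left A2 (mul_nonneg h0dK h0dt); linarith [this]
      have S4 : dK * da * (ft * (qRt - q8)) ≤ dK * da * dt * (rT - d8) := by
        have := mul_le_mul_of_nonneg_left A3 (mul_nonneg h0dK h0da); linarith [this]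
      have P1 : 0 ≤ dK * dt * fa * (q5 - q67 + qRa - q9) :=
        mul_nonneg (mul_nonneg (mul_nonneg h0dK h0dt) h0fa) (by linarith)
      have P2 : 0 ≤ dK * da * ft * (q5 - q67 + qRt - q8) :=
        mul_nonneg (mul_nonneg (mul_nonneg h0dK h0da) h0ft) (by linarith)
      have tot : 0 ≤ dK * da * dt * ((u5 + rA + rT) - (d67 + d9 + d8)) := by linarith [S1, S2, S3, S4, P1, P2]
      have hP : 0 < dK * da * dt := mul_pos (mul_pos hKpos hapos) htpos
      have := (mul_nonneg_iff_of_pos_left hP).1 tot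
      linarith
    · -- degenerate: one of `da`, `dt` vanishes; then both do, and only `d67 ≤ u5` remains
      have hboth : da = 0 ∧ dt = 0 := by
        by_cases ha0 : da = 0
        · refine ⟨ha0, ?_⟩
          -- Harris: μ{a↮t}·μ{a↮c} ≤ da = 0, and dK ≤ μ{a↮c} forces μ{a↮t} = 0 ≥ dt
          have h1 : μ.real ((openConn a t)ᶜ) * μ.real ((openConn a c)ᶜ) = 0 :=
            le_antisymm (ha0 ▸ harris_a) (mul_nonneg measureReal_nonneg measureReal_nonneg)
          rcases mul_eq_zero.1 h1 with h | h
          · exact le_antisymm (h ▸ hdt_le_ta) h0dt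
          · exact absurd (le_antisymm (h ▸ hdK_le_ac) h0dK) hK0
        · have ht0 : dt = 0 := by
            by_contra ht0
            exact hmain ⟨lt_of_le_of_ne h0da (Ne.symm ha0), lt_of_le_of_ne h0dt (Ne.symm ht0)⟩
          refine ⟨?_, ht0⟩
          have h1 : μ.real ((openConn t a)ᶜ) * μ.real ((openConn t c)ᶜ) = 0 :=
            le_antisymm (ht0 ▸ harris_t) (mul_nonneg measureReal_nonneg measureReal_nonneg)
          rcases mul_eq_zero.1 h1 with h | h
          · exact le_antisymm (h ▸ hda_le_at) h0da
          · exact absurd (le_antisymm (h ▸ hdK_le_tc) h0dK) hK0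
      obtain ⟨ha0, ht0⟩ := hboth
      have hrA0 : rA = 0 := le_antisymm (ha0 ▸ hrA) h0rA
      have hd90 : d9 = 0 := le_antisymm (ha0 ▸ hd9) h0d9
      have hrT0 : rT = 0 := le_antisymm (ht0 ▸ hrT) h0rT
      have hd80 : d8 = 0 := le_antisymm (ht0 ▸ hd8) h0d8
      rw [hrA0, hd90, hrT0, hd80]
      have h1 : 0 ≤ fK * (q5 - q67) := mul_nonneg h0fK hKN0
      have h2 : 0 ≤ dK * (u5 - d67) := le_trans h1 A1
      have h3 := (mul_nonneg_iff_of_pos_left hKpos).1 h2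
      linarith

end KNGoodThreeKN

end Summit.CriticalPhenomena.PercolationContinuityZ3.Theorems
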